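import Summits.CriticalPhenomena.PercolationContinuityZ3.Theorems.Transplant.FKConnectivityAllQAntipodalRootFormSerPairReal

/-!
# Connectivity correlation inequalities for `φ_{w,q}`, every `q > 0` — ROOT-FORM CALCULUS, file 61z: **THE `q`-FREE `maj₃` INEQUALITY ON
# EVERY 2-CONNECTED SERIES–PARALLEL HOST** (`Z_H(z,q)² Cov_{φ_{z,q}}(maj₃, g) ∈ (q−1)·ℝ≥0[z,q]`)

Support file (`--supports stmt-CriticalPhenomena-4575`), FK sub-lane `prim-bschramm-fk-2` (gen 29); builds on p205010 (kernel theorem,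
internal audit signed; external expert review pending).  No definitions, no named facts, no sorries; standard axioms.  Memo
FROM-fk-2-g28-ROOT-FORM.md §4 (THE REDUCTION THEOREM) — here a kernel theorem.

`isTTSP_realEnv_facts`: for every two-terminal series–parallel `𝓔` between `a, b`, any two distinct special edges `y, z ∈ 𝓔` and every cell
`M` (free) / `C` (contracted) inside `𝓔 \ {y,z}` (disjoint), the real environment satisfies the five facts of the word theorem — by induction on
the series–parallel structure: a parallel (theta) split of the specials is THEOREM G27 for real boxes (file 61s `realPairEnv_facts`), a series split
is the (B2)/(B3) base (file 61y), and a special-free parallel / series component is a general attachment (file 61x).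
**`maj3_levels_le_nonpos_of_isTTSP`**: consequently, for every host `H = x ∥ 𝓔` — i.e. EVERY 2-connected series–parallel graph `H` presented
from an edge `x = ab ∉ 𝓔` — with three distinct special edges `x, y, z`, every cell with `x, y, z` free, every increasing `g` blind to
`x, y, z` and every level `J`: `Σ_{γ : level ≤ J} (maj₃(γ∪C) − maj₃(γᶜ∪C))(g(γ∪C) − g(γᶜ∪C)) ≤ 0`, i.e. every coefficient, in the edge odds
`z` and in `q`, of `Z_H(z,q)² Cov_{φ_{z,q}}(maj₃(ω_x,ω_y,ω_z), g)/(q − 1)` is nonnegative (Conjecture `C_∞⁺` at level 3, majority type, on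
series–parallel graphs).
[cite: Grimmett2006, §1.4 eq. (1.20) (p. 15); §3.8 Thm. (3.90) (pp. 61–62); §3.9 (pp. 63–64)] [cite: Wagner2006, Thm. 5.8(d), §5.3]
-/

noncomputable section

namespace Summit.CriticalPhenomena.PercolationContinuityZ3.Theorems

namespace FK

namespace RootForm

open SimpleGraph Finset Literature.Probability.LatticeModels Literature.Probability.Percolation
open scoped Classical

variable {V : Type*} [Fintype V]

omit [Fintype V] in
/-- `a ↔ b` iff `b ↔ a`. [folklore] -/
theorem reachB_comm (X : Finset (Sym2 V)) (a b : V) : reachB X a b = reachB X b a := by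
  unfold reachB; rw [Bool.eq_iff_iff]; simp only [decide_eq_true_eq]; exact ⟨Reachable.symm, Reachable.symm⟩

/-- The real environment does not see the order of the poles. [folklore] -/
theorem realEnv_pole_comm (M C : Finset (Sym2 V)) (a b : V) (y z : Sym2 V) : realEnv M C a b y z = realEnv M C b a y z := by
  funext β; simp only [realEnv, realPDat, reachB_comm _ a b]

section Induction

/-- **The five facts for the real environment of every two-terminal series–parallel edge set with two special edges, in every cell.**
[cite: Grimmett2006, §3.8 Thm. (3.90) (pp. 61–62); §3.9 (pp. 63–64)] [cite: Wagner2006, Thm. 5.8(d), §5.3] -/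
theorem isTTSP_realEnv_facts {E : Finset (Sym2 V)} {a b : V} (hE : IsTTSP E a b) :
    ∀ {uy vy uz vz : V}, s(uy, vy) ∈ E → s(uz, vz) ∈ E → s(uy, vy) ≠ s(uz, vz) →
    ∀ {M C : Finset (Sym2 V)}, M ⊆ (E.erase s(uy, vy)).erase s(uz, vz) → C ⊆ (E.erase s(uy, vy)).erase s(uz, vz) → Disjoint M C →
    (∀ h0 h1 : ↥M.powerset → ℝ, Monotone h0 → Monotone h1 → (∀ γ, 0 ≤ h0 γ) → (∀ γ, h0 γ ≤ h1 γ) → ∀ J : ℤ,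
        0 ≤ Mt (realEnv M C a b s(uy, vy) s(uz, vz)) h0 h1 J)
      ∧ (∀ h0 h1 : Bool × ↥M.powerset → ℝ, Monotone h0 → Monotone h1 → (∀ p, 0 ≤ h0 p) → (∀ p, h0 p ≤ h1 p) → ∀ J : ℤ,
        0 ≤ Mt (parE (realEnv M C a b s(uy, vy) s(uz, vz))) h0 h1 J)
      ∧ (∀ h : ↥M.powerset → ℝ, Monotone h → (∀ γ, 0 ≤ h γ) → ∀ J : ℤ, 0 ≤ ∑ γ, h γ * (realEnv M C a b s(uy, vy) s(uz, vz) γ).andDel J)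
      ∧ (∀ h : ↥M.powerset → ℝ, Monotone h → (∀ γ, 0 ≤ h γ) → ∀ J : ℤ, 0 ≤ ∑ γ, h γ * (realEnv M C a b s(uy, vy) s(uz, vz) γ).andCon J)
      ∧ (∀ h0 h1 : ↥M.powerset → ℝ, Monotone h0 → Monotone h1 → (∀ γ, 0 ≤ h0 γ) → (∀ γ, h0 γ ≤ h1 γ) → ∀ J : ℤ,
          0 ≤ ∑ γ, (h1 γ * (realEnv M C a b s(uy, vy) s(uz, vz) γ).andE1 J + h0 γ * (realEnv M C a b s(uy, vy) s(uz, vz) γ).andE2 J)) := by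
  induction hE with
  | @edge s t hst =>
    intro uy vy uz vz hy hz hyz
    rw [Finset.mem_singleton] at hy hz
    exact absurd (hy.trans hz.symm) hyz
  | @parallel E₁ E₂ s t h₁ h₂ hd hV ih₁ ih₂ =>
    intro uy vy uz vz hy hz hyz M C hM hC hMC
    have hMe : M ⊆ E₁ ∪ E₂ := hM.trans ((Finset.erase_subset _ _).trans (Finset.erase_subset _ _))
    have hCe : C ⊆ E₁ ∪ E₂ := hC.trans ((Finset.erase_subset _ _).trans (Finset.erase_subset _ _))
    have hyM : s(uy, vy) ∉ M := fun h => (Finset.mem_erase.1 (Finset.mem_of_mem_erase (hM h))).1 rfl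
    have hzM : s(uz, vz) ∉ M := fun h => (Finset.mem_erase.1 (hM h)).1 rfl
    have hyC : s(uy, vy) ∉ C := fun h => (Finset.mem_erase.1 (Finset.mem_of_mem_erase (hC h))).1 rfl
    have hzC : s(uz, vz) ∉ C := fun h => (Finset.mem_erase.1 (hC h)).1 rfl
    have hV' : ∀ w : V, (∃ e ∈ E₂, w ∈ e) → (∃ e ∈ E₁, w ∈ e) → w = s ∨ w = t := fun w h2 h1 => hV w h1 h2
    -- cell pieces
    have cM : ∀ {P Q : Finset (Sym2 V)} (x : Sym2 V), M ⊆ P ∪ Q → x ∉ M → M ∩ P ⊆ P.erase x := fun x _ hx e he =>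
      Finset.mem_erase.2 ⟨fun h => hx (h ▸ (Finset.mem_inter.1 he).1), (Finset.mem_inter.1 he).2⟩
    have dMC : ∀ P : Finset (Sym2 V), Disjoint (M ∩ P) (C ∩ P) :=
      fun P => Finset.disjoint_of_subset_left Finset.inter_subset_left (Finset.disjoint_of_subset_right Finset.inter_subset_left hMC)
    rcases Finset.mem_union.1 hy with hy1 | hy2 <;> rcases Finset.mem_union.1 hz with hz1 | hz2
    · -- both in E₁: attach E₂
      have hM1 : M ∩ E₁ ⊆ (E₁.erase s(uy, vy)).erase s(uz, vz) := fun e he =>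
        Finset.mem_erase.2 ⟨fun h => hzM (h ▸ (Finset.mem_inter.1 he).1), Finset.mem_erase.2
          ⟨fun h => hyM (h ▸ (Finset.mem_inter.1 he).1), (Finset.mem_inter.1 he).2⟩⟩
      have hC1 : C ∩ E₁ ⊆ (E₁.erase s(uy, vy)).erase s(uz, vz) := fun e he =>
        Finset.mem_erase.2 ⟨fun h => hzC (h ▸ (Finset.mem_inter.1 he).1), Finset.mem_erase.2
          ⟨fun h => hyC (h ▸ (Finset.mem_inter.1 he).1), (Finset.mem_inter.1 he).2⟩⟩
      have key := realEnv_attP_facts (MA := M ∩ E₂) (CA := C ∩ E₂) h₂ hd.symm hV' Finset.inter_subset_right Finset.inter_subset_right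
        (Finset.insert_subset hy1 (Finset.insert_subset hz1 Finset.inter_subset_right)) Finset.inter_subset_right
        (ih₁ hy1 hz1 hyz hM1 hC1 (dMC E₁))
      have eM : M ∩ E₂ ∪ M ∩ E₁ = M := by rw [← Finset.inter_union_distrib_left, Finset.union_comm, Finset.inter_eq_left.2 hMe]
      have eC : C ∩ E₂ ∪ C ∩ E₁ = C := by rw [← Finset.inter_union_distrib_left, Finset.union_comm, Finset.inter_eq_left.2 hCe]
      rw [eM, eC] at key; exact key
    · -- y ∈ E₁, z ∈ E₂: theta pair
      have key := realPairEnv_facts (My := M ∩ E₁) (Cy := C ∩ E₁) (Mz := M ∩ E₂) (Cz := C ∩ E₂) h₁ h₂ hd hV hy1 hz2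
        (cM _ hMe hyM) (fun e he => Finset.mem_erase.2 ⟨fun h => hyC (h ▸ (Finset.mem_inter.1 he).1), (Finset.mem_inter.1 he).2⟩)
        (cM _ (by rwa [Finset.union_comm]) hzM)
        (fun e he => Finset.mem_erase.2 ⟨fun h => hzC (h ▸ (Finset.mem_inter.1 he).1), (Finset.mem_inter.1 he).2⟩) (dMC E₁) (dMC E₂)
      have eM : M ∩ E₁ ∪ M ∩ E₂ = M := by rw [← Finset.inter_union_distrib_left, Finset.inter_eq_left.2 hMe]
      have eC : C ∩ E₁ ∪ C ∩ E₂ = C := by rw [← Finset.inter_union_distrib_left, Finset.inter_eq_left.2 hCe]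
      rw [eM, eC] at key; exact key
    · -- y ∈ E₂, z ∈ E₁: theta pair, parts swapped
      have key := realPairEnv_facts (My := M ∩ E₂) (Cy := C ∩ E₂) (Mz := M ∩ E₁) (Cz := C ∩ E₁) h₂ h₁ hd.symm hV' hy2 hz1
        (cM _ (by rwa [Finset.union_comm]) hyM)
        (fun e he => Finset.mem_erase.2 ⟨fun h => hyC (h ▸ (Finset.mem_inter.1 he).1), (Finset.mem_inter.1 he).2⟩)
        (cM _ hMe hzM)
        (fun e he => Finset.mem_erase.2 ⟨fun h => hzC (h ▸ (Finset.mem_inter.1 he).1), (Finset.mem_inter.1 he).2⟩) (dMC E₂) (dMC E₁)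
      have eM : M ∩ E₂ ∪ M ∩ E₁ = M := by rw [← Finset.inter_union_distrib_left, Finset.union_comm, Finset.inter_eq_left.2 hMe]
      have eC : C ∩ E₂ ∪ C ∩ E₁ = C := by rw [← Finset.inter_union_distrib_left, Finset.union_comm, Finset.inter_eq_left.2 hCe]
      rw [eM, eC] at key; exact key
    · -- both in E₂: attach E₁
      have hM2 : M ∩ E₂ ⊆ (E₂.erase s(uy, vy)).erase s(uz, vz) := fun e he =>
        Finset.mem_erase.2 ⟨fun h => hzM (h ▸ (Finset.mem_inter.1 he).1), Finset.mem_erase.2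
          ⟨fun h => hyM (h ▸ (Finset.mem_inter.1 he).1), (Finset.mem_inter.1 he).2⟩⟩
      have hC2 : C ∩ E₂ ⊆ (E₂.erase s(uy, vy)).erase s(uz, vz) := fun e he =>
        Finset.mem_erase.2 ⟨fun h => hzC (h ▸ (Finset.mem_inter.1 he).1), Finset.mem_erase.2
          ⟨fun h => hyC (h ▸ (Finset.mem_inter.1 he).1), (Finset.mem_inter.1 he).2⟩⟩
      have key := realEnv_attP_facts (MA := M ∩ E₁) (CA := C ∩ E₁) h₁ hd hV Finset.inter_subset_right Finset.inter_subset_right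
        (Finset.insert_subset hy2 (Finset.insert_subset hz2 Finset.inter_subset_right)) Finset.inter_subset_right
        (ih₂ hy2 hz2 hyz hM2 hC2 (dMC E₂))
      have eM : M ∩ E₁ ∪ M ∩ E₂ = M := by rw [← Finset.inter_union_distrib_left, Finset.inter_eq_left.2 hMe]
      have eC : C ∩ E₁ ∪ C ∩ E₂ = C := by rw [← Finset.inter_union_distrib_left, Finset.inter_eq_left.2 hCe]
      rw [eM, eC] at key; exact key
  | @series E₁ E₂ a m b h₁ h₂ hd hV ha hb ih₁ ih₂ =>
    intro uy vy uz vz hy hz hyz M C hM hC hMC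
    have hMe : M ⊆ E₁ ∪ E₂ := hM.trans ((Finset.erase_subset _ _).trans (Finset.erase_subset _ _))
    have hCe : C ⊆ E₁ ∪ E₂ := hC.trans ((Finset.erase_subset _ _).trans (Finset.erase_subset _ _))
    have hyM : s(uy, vy) ∉ M := fun h => (Finset.mem_erase.1 (Finset.mem_of_mem_erase (hM h))).1 rfl
    have hzM : s(uz, vz) ∉ M := fun h => (Finset.mem_erase.1 (hM h)).1 rfl
    have hyC : s(uy, vy) ∉ C := fun h => (Finset.mem_erase.1 (Finset.mem_of_mem_erase (hC h))).1 rfl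
    have hzC : s(uz, vz) ∉ C := fun h => (Finset.mem_erase.1 (hC h)).1 rfl
    have ham : a ≠ m := h₁.ne
    have hbm : b ≠ m := h₂.ne.symm
    have hab : a ≠ b := by obtain ⟨e, he, hae⟩ := h₁.left_mem; exact fun h => hb e he (h ▸ hae)
    have hV' : ∀ w : V, (∃ e ∈ E₂, w ∈ e) → (∃ e ∈ E₁, w ∈ e) → w = m := fun w h2 h1 => hV w h1 h2
    have dMC : ∀ P : Finset (Sym2 V), Disjoint (M ∩ P) (C ∩ P) :=
      fun P => Finset.disjoint_of_subset_left Finset.inter_subset_left (Finset.disjoint_of_subset_right Finset.inter_subset_left hMC)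
    have sub : ∀ {P : Finset (Sym2 V)} {S : Finset (Sym2 V)}, (∀ x, x ∈ S → x ∉ ({s(uy, vy), s(uz, vz)} : Finset (Sym2 V))) →
        S ∩ P ⊆ (P.erase s(uy, vy)).erase s(uz, vz) := fun hS e he =>
      Finset.mem_erase.2 ⟨fun h => hS e (Finset.mem_inter.1 he).1 (by rw [h]; simp), Finset.mem_erase.2
        ⟨fun h => hS e (Finset.mem_inter.1 he).1 (by rw [h]; simp), (Finset.mem_inter.1 he).2⟩⟩
    have hMS : ∀ x, x ∈ M → x ∉ ({s(uy, vy), s(uz, vz)} : Finset (Sym2 V)) := fun x hx h => by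
      rw [Finset.mem_insert, Finset.mem_singleton] at h
      rcases h with rfl | rfl
      · exact hyM hx
      · exact hzM hx
    have hCS : ∀ x, x ∈ C → x ∉ ({s(uy, vy), s(uz, vz)} : Finset (Sym2 V)) := fun x hx h => by
      rw [Finset.mem_insert, Finset.mem_singleton] at h
      rcases h with rfl | rfl
      · exact hyC hx
      · exact hzC hx
    rcases Finset.mem_union.1 hy with hy1 | hy2 <;> rcases Finset.mem_union.1 hz with hz1 | hz2
    · -- both in E₁: attach E₂ at the far pole (poles reversed)
      have inner := ih₁ hy1 hz1 hyz (sub hMS) (sub hCS) (dMC E₁)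
      rw [realEnv_pole_comm] at inner
      have key := realEnv_attS_facts (MA := M ∩ E₂) (CA := C ∩ E₂) (M := M ∩ E₁) (C := C ∩ E₁) h₂.symm hd.symm hV' hb ha hbm ham hab.symm
        Finset.inter_subset_right Finset.inter_subset_right
        (Finset.insert_subset hy1 (Finset.insert_subset hz1 Finset.inter_subset_right)) Finset.inter_subset_right inner
      rw [realEnv_pole_comm] at key
      have eM : M ∩ E₂ ∪ M ∩ E₁ = M := by rw [← Finset.inter_union_distrib_left, Finset.union_comm, Finset.inter_eq_left.2 hMe]
      have eC : C ∩ E₂ ∪ C ∩ E₁ = C := by rw [← Finset.inter_union_distrib_left, Finset.union_comm, Finset.inter_eq_left.2 hCe]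
      rw [eM, eC] at key; exact key
    · -- y ∈ E₁, z ∈ E₂: series pair
      have key := realSerPairEnv_facts (My := M ∩ E₁) (Cy := C ∩ E₁) (Mz := M ∩ E₂) (Cz := C ∩ E₂) h₁ h₂ hd hV ha hb hy1 hz2
        (fun e he => Finset.mem_erase.2 ⟨fun h => hyM (h ▸ (Finset.mem_inter.1 he).1), (Finset.mem_inter.1 he).2⟩)
        (fun e he => Finset.mem_erase.2 ⟨fun h => hyC (h ▸ (Finset.mem_inter.1 he).1), (Finset.mem_inter.1 he).2⟩)
        (fun e he => Finset.mem_erase.2 ⟨fun h => hzM (h ▸ (Finset.mem_inter.1 he).1), (Finset.mem_inter.1 he).2⟩)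
        (fun e he => Finset.mem_erase.2 ⟨fun h => hzC (h ▸ (Finset.mem_inter.1 he).1), (Finset.mem_inter.1 he).2⟩) (dMC E₁) (dMC E₂)
      have eM : M ∩ E₁ ∪ M ∩ E₂ = M := by rw [← Finset.inter_union_distrib_left, Finset.inter_eq_left.2 hMe]
      have eC : C ∩ E₁ ∪ C ∩ E₂ = C := by rw [← Finset.inter_union_distrib_left, Finset.inter_eq_left.2 hCe]
      rw [eM, eC] at key; exact key
    · -- y ∈ E₂, z ∈ E₁: series pair, poles reversed
      have key := realSerPairEnv_facts (My := M ∩ E₂) (Cy := C ∩ E₂) (Mz := M ∩ E₁) (Cz := C ∩ E₁) h₂.symm h₁.symm hd.symm hV' hb ha hy2 hz1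
        (fun e he => Finset.mem_erase.2 ⟨fun h => hyM (h ▸ (Finset.mem_inter.1 he).1), (Finset.mem_inter.1 he).2⟩)
        (fun e he => Finset.mem_erase.2 ⟨fun h => hyC (h ▸ (Finset.mem_inter.1 he).1), (Finset.mem_inter.1 he).2⟩)
        (fun e he => Finset.mem_erase.2 ⟨fun h => hzM (h ▸ (Finset.mem_inter.1 he).1), (Finset.mem_inter.1 he).2⟩)
        (fun e he => Finset.mem_erase.2 ⟨fun h => hzC (h ▸ (Finset.mem_inter.1 he).1), (Finset.mem_inter.1 he).2⟩) (dMC E₂) (dMC E₁)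
      rw [realEnv_pole_comm] at key
      have eM : M ∩ E₂ ∪ M ∩ E₁ = M := by rw [← Finset.inter_union_distrib_left, Finset.union_comm, Finset.inter_eq_left.2 hMe]
      have eC : C ∩ E₂ ∪ C ∩ E₁ = C := by rw [← Finset.inter_union_distrib_left, Finset.union_comm, Finset.inter_eq_left.2 hCe]
      rw [eM, eC] at key; exact key
    · -- both in E₂: attach E₁ at the near pole
      have key := realEnv_attS_facts (MA := M ∩ E₁) (CA := C ∩ E₁) (M := M ∩ E₂) (C := C ∩ E₂) h₁ hd hV ha hb ham hbm hab
        Finset.inter_subset_right Finset.inter_subset_right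
        (Finset.insert_subset hy2 (Finset.insert_subset hz2 Finset.inter_subset_right)) Finset.inter_subset_right
        (ih₂ hy2 hz2 hyz (sub hMS) (sub hCS) (dMC E₂))
      have eM : M ∩ E₁ ∪ M ∩ E₂ = M := by rw [← Finset.inter_union_distrib_left, Finset.inter_eq_left.2 hMe]
      have eC : C ∩ E₁ ∪ C ∩ E₂ = C := by rw [← Finset.inter_union_distrib_left, Finset.inter_eq_left.2 hCe]
      rw [eM, eC] at key; exact key

end Induction

section Main

variable {E M C : Finset (Sym2 V)} {a b uy vy uz vz : V}

/-- **THEOREM (the `q`-free `maj₃` inequality on every 2-connected series–parallel host).**  Let `𝓔` be two-terminal series–parallel between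
`a, b` and `x = ab ∉ 𝓔` (so `H = 𝓔 ∪ {x}` is an arbitrary 2-connected series–parallel graph presented from its edge `x`); let `y, z ∈ 𝓔` be two
further distinct special edges and `(M, C)` any cell inside `𝓔 \ {y, z}` (free / contracted, disjoint; `x, y, z` free).  Then for every increasing
`g` blind to `x, y, z` and every level `J`:
`Σ_{γ ⊆ M ∪ {x,y,z} : k(γ∪C)+k(γᶜ∪C) ≤ J} (maj₃(γ∪C) − maj₃(γᶜ∪C))·(g(γ∪C) − g(γᶜ∪C)) ≤ 0`,
i.e. every coefficient — in the edge odds and in the cluster weight `q` — of `Z_H(z,q)² Cov_{φ_{z,q}}(maj₃(ω_x,ω_y,ω_z), g)/(q − 1)` is nonnegative: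
Conjecture `C_∞⁺` at level 3 for the majority type on series–parallel graphs (memo FROM-fk-2-g28-ROOT-FORM §4, now kernel-checked; the other
level-3 types are gens 20–22).  Proof: root identity (file 61n) + `isTTSP_realEnv_facts`.
[cite: Grimmett2006, §1.4 eq. (1.20) (p. 15); §3.8 Thm. (3.90) (pp. 61–62); §3.9 (pp. 63–64)] [cite: Wagner2006, Thm. 5.8(d), §5.3] -/
theorem maj3_levels_le_nonpos_of_isTTSP (hE : IsTTSP E a b) (hx : s(a, b) ∉ E) (hy : s(uy, vy) ∈ E) (hz : s(uz, vz) ∈ E)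
    (hyz : s(uy, vy) ≠ s(uz, vz)) (hM : M ⊆ (E.erase s(uy, vy)).erase s(uz, vz)) (hC : C ⊆ (E.erase s(uy, vy)).erase s(uz, vz))
    (hMC : Disjoint M C)
    {g : Finset (Sym2 V) → ℝ} (hgx : ∀ A : Finset (Sym2 V), g (insert s(a, b) A) = g A)
    (hgy : ∀ A : Finset (Sym2 V), g (insert s(uy, vy) A) = g A) (hgz : ∀ A : Finset (Sym2 V), g (insert s(uz, vz) A) = g A)
    (hmono : ∀ ⦃X Y : Finset (Sym2 V)⦄, X ⊆ Y → g X ≤ g Y) (J : ℕ) :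
    ∑ γ ∈ (insert s(a, b) (insert s(uy, vy) (insert s(uz, vz) M))).powerset with
        apExpC (insert s(a, b) (insert s(uy, vy) (insert s(uz, vz) M))) C γ ≤ J,
        ((((fun X : Finset (Sym2 V) => if (s(a, b) ∈ X ∧ s(uy, vy) ∈ X) ∨ (s(a, b) ∈ X ∧ s(uz, vz) ∈ X) ∨
              (s(uy, vy) ∈ X ∧ s(uz, vz) ∈ X) then (1 : ℝ) else 0) (γ ∪ C)) -
            ((fun X : Finset (Sym2 V) => if (s(a, b) ∈ X ∧ s(uy, vy) ∈ X) ∨ (s(a, b) ∈ X ∧ s(uz, vz) ∈ X) ∨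
              (s(uy, vy) ∈ X ∧ s(uz, vz) ∈ X) then (1 : ℝ) else 0)
                ((insert s(a, b) (insert s(uy, vy) (insert s(uz, vz) M))) \ γ ∪ C))) *
          (g (γ ∪ C) - g ((insert s(a, b) (insert s(uy, vy) (insert s(uz, vz) M))) \ γ ∪ C))) ≤ 0 := by
  have hMe : M ⊆ E := hM.trans ((Finset.erase_subset _ _).trans (Finset.erase_subset _ _))
  have hCe : C ⊆ E := hC.trans ((Finset.erase_subset _ _).trans (Finset.erase_subset _ _))
  have hyM : s(uy, vy) ∉ M := fun h => (Finset.mem_erase.1 (Finset.mem_of_mem_erase (hM h))).1 rfl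
  have hzM : s(uz, vz) ∉ M := fun h => (Finset.mem_erase.1 (hM h)).1 rfl
  have hyC : s(uy, vy) ∉ C := fun h => (Finset.mem_erase.1 (Finset.mem_of_mem_erase (hC h))).1 rfl
  have hzC : s(uz, vz) ∉ C := fun h => (Finset.mem_erase.1 (hC h)).1 rfl
  exact maj3_levels_le_nonpos_of_rootFact (fun h => hx (hMe h)) hyM hzM (fun h => hx (hCe h)) hyC hzC
    (fun h => hx (h ▸ hy)) (fun h => hx (h ▸ hz)) hyz
    (fun w mw nw J => (isTTSP_realEnv_facts hE hy hz hyz hM hC hMC).1 w w mw mw nw (fun _ => le_rfl) J) hgx hgy hgz hmono J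

/-- **COROLLARY (`maj₃` for every `0 ≤ q ≤ 1` on every 2-connected series–parallel host, via the Abel bridge of `…Qfree`).**
In the setting of `maj3_levels_le_nonpos_of_isTTSP`: `apPsiC q (M ∪ {x,y,z}) C maj₃ g ≤ 0`, i.e. the antipodal (squared-partition-function)
form of `Cov_{φ_{p,q}}(maj₃(ω_x,ω_y,ω_z), g) ≥ 0` holds coefficientwise in the edge odds for every random-cluster measure with `q ≤ 1` on
`H = 𝓔 ∪ x`, in every cell.
[cite: Grimmett2006, §3.8 Thm. (3.90) (pp. 61–62); §3.9 (pp. 63–64)] [cite: Wagner2006, Thm. 5.8(d), §5.3] -/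
theorem apPsiC_maj3_nonpos_of_isTTSP {q : ℝ} (hq0 : 0 ≤ q) (hq1 : q ≤ 1) (hE : IsTTSP E a b) (hx : s(a, b) ∉ E)
    (hy : s(uy, vy) ∈ E) (hz : s(uz, vz) ∈ E)
    (hyz : s(uy, vy) ≠ s(uz, vz)) (hM : M ⊆ (E.erase s(uy, vy)).erase s(uz, vz)) (hC : C ⊆ (E.erase s(uy, vy)).erase s(uz, vz))
    (hMC : Disjoint M C)
    {g : Finset (Sym2 V) → ℝ} (hgx : ∀ A : Finset (Sym2 V), g (insert s(a, b) A) = g A)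
    (hgy : ∀ A : Finset (Sym2 V), g (insert s(uy, vy) A) = g A) (hgz : ∀ A : Finset (Sym2 V), g (insert s(uz, vz) A) = g A)
    (hmono : ∀ ⦃X Y : Finset (Sym2 V)⦄, X ⊆ Y → g X ≤ g Y) :
    apPsiC q (insert s(a, b) (insert s(uy, vy) (insert s(uz, vz) M))) C
      (fun X => if (s(a, b) ∈ X ∧ s(uy, vy) ∈ X) ∨ (s(a, b) ∈ X ∧ s(uz, vz) ∈ X) ∨ (s(uy, vy) ∈ X ∧ s(uz, vz) ∈ X) then 1 else 0)
      g ≤ 0 :=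
  sum_pow_mul_nonpos_of_levels_le (insert s(a, b) (insert s(uy, vy) (insert s(uz, vz) M))).powerset
    (apExpC (insert s(a, b) (insert s(uy, vy) (insert s(uz, vz) M))) C)
    (fun γ => (((fun X : Finset (Sym2 V) => if (s(a, b) ∈ X ∧ s(uy, vy) ∈ X) ∨ (s(a, b) ∈ X ∧ s(uz, vz) ∈ X) ∨
          (s(uy, vy) ∈ X ∧ s(uz, vz) ∈ X) then (1 : ℝ) else 0) (γ ∪ C)) -
        ((fun X : Finset (Sym2 V) => if (s(a, b) ∈ X ∧ s(uy, vy) ∈ X) ∨ (s(a, b) ∈ X ∧ s(uz, vz) ∈ X) ∨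
          (s(uy, vy) ∈ X ∧ s(uz, vz) ∈ X) then (1 : ℝ) else 0) ((insert s(a, b) (insert s(uy, vy) (insert s(uz, vz) M))) \ γ ∪ C))) *
      (g (γ ∪ C) - g ((insert s(a, b) (insert s(uy, vy) (insert s(uz, vz) M))) \ γ ∪ C)))
    hq0 hq1 fun J => maj3_levels_le_nonpos_of_isTTSP hE hx hy hz hyz hM hC hMC hgx hgy hgz hmono J

end Main

end RootForm

end FK

end Summit.CriticalPhenomena.PercolationContinuityZ3.Theorems

end
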